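import Summits.BirchSwinnertonDyer.BirchSwinnertonDyer.Theorems.ClassRecordThreeCartanOnePlaceDegreeLawAtThreeGramPrelims
import Summits.BirchSwinnertonDyer.BirchSwinnertonDyer.Theorems.ClassRecordThreeCartanOnePlaceDegreeLawAtThreeGramNorms
import HarnessLib

/-!
# Crux NUM `CartanOnePlaceDegreeLawAtThree` (item 24801) — (GRAM) inputs: the real Petersson pairing on `ℂ[G]·u`

Seat `bsd-stepL-tam3-p1` g30 (LEAD of 24801; `--supports` 24801). The component-summed REAL Petersson pairing
`petPair R Fq v w = Σ_g ∫_{Fq} Re(v_g w̄_g) y² dμ` of two induced vectors and its algebra on `ℂ[G]·u` under the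
(GRAM) finiteness hypothesis on `u` (every component of `u` has finite Petersson norm over `Fq`):
symmetric (`petPair_comm`), additive and `ℝ`-homogeneous in the first variable on `ℂ[G]·u`
(`petPair_add_left`, `petPair_smul_left`), `indRep`-invariant (`petPair_indRep`), with
`petPair v v = (Σ_g ∫⁻_{Fq} ‖v_g‖² y²).toReal` (`petPair_self`) and `petPair v v > 0` for `v ≠ 0`
(`petPair_self_pos`, from `setLIntegral_pet_pos`). These are the bilinear-algebra inputs of the Gram matrix of (GRAM).
Nothing about NUM or any curve; BSD is proved for no curve. [cite: ShimuraIATAF1971, §2.1 and §3.5] [cite: Iwaniec2002, §2.3]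
-/

set_option linter.dupNamespace false
set_option autoImplicit false

noncomputable section

open scoped Classical Pointwise MatrixGroups ModularForm ENNReal UpperHalfPlane ComplexConjugate
open MeasureTheory

namespace Summit.BirchSwinnertonDyer.BirchSwinnertonDyer.Theorems.CartanCover

open Literature.NumberTheory.Automorphic Literature.NumberTheory.EllipticCurves.ModularForms

/-! ## Real-analysis helpers on one component -/

/-- `τ ↦ ‖f τ‖² (Im τ)²` is integrable on `Fq` when its `lintegral` is finite (`f` continuous). -/
theorem integrableOn_normSq_mul_imSq {f : ℍ → ℂ} (hf : Continuous f) {Fq : Set ℍ}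
    (h : ∫⁻ τ in Fq, ENNReal.ofReal (‖f τ‖ ^ 2 * τ.im ^ 2) < ⊤) :
    IntegrableOn (fun τ : ℍ => ‖f τ‖ ^ 2 * τ.im ^ 2) Fq := by
  have hm : Measurable fun τ : ℍ => ‖f τ‖ ^ 2 * τ.im ^ 2 :=
    (((continuous_norm.comp hf).pow 2).mul (UpperHalfPlane.continuous_im.pow 2)).measurable
  refine ⟨hm.aestronglyMeasurable, ?_⟩
  rw [hasFiniteIntegral_iff_ofReal (Filter.Eventually.of_forall fun τ => by positivity)]
  exact h

/-- The pointwise bound `|Re(a b̄)| y² ≤ ‖a‖² y² + ‖b‖² y²`. -/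
theorem abs_re_mul_conj_mul_le (a b : ℂ) (y : ℝ) :
    |(a * conj b).re * y ^ 2| ≤ ‖a‖ ^ 2 * y ^ 2 + ‖b‖ ^ 2 * y ^ 2 := by
  have h1 : |(a * conj b).re| ≤ ‖a‖ * ‖b‖ := by
    have h := Complex.abs_re_le_norm (a * conj b)
    rwa [norm_mul, Complex.norm_conj] at h
  have h2 : ‖a‖ * ‖b‖ ≤ ‖a‖ ^ 2 + ‖b‖ ^ 2 := by nlinarith [norm_nonneg a, norm_nonneg b, sq_nonneg (‖a‖ - ‖b‖)]
  rw [abs_mul, abs_of_nonneg (sq_nonneg y)]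
  nlinarith [sq_nonneg y, abs_nonneg ((a * conj b).re)]

/-- `τ ↦ Re(f τ · conj (g τ)) (Im τ)²` is integrable on `Fq` when both norms have finite `lintegral`. -/
theorem integrableOn_re_mul_conj_mul_imSq {f g : ℍ → ℂ} (hf : Continuous f) (hg : Continuous g) {Fq : Set ℍ}
    (hF : ∫⁻ τ in Fq, ENNReal.ofReal (‖f τ‖ ^ 2 * τ.im ^ 2) < ⊤)
    (hG : ∫⁻ τ in Fq, ENNReal.ofReal (‖g τ‖ ^ 2 * τ.im ^ 2) < ⊤) :
    IntegrableOn (fun τ : ℍ => (f τ * conj (g τ)).re * τ.im ^ 2) Fq := by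
  have hm : Measurable fun τ : ℍ => (f τ * conj (g τ)).re * τ.im ^ 2 :=
    ((Complex.continuous_re.comp (hf.mul (Complex.continuous_conj.comp hg))).mul
      (UpperHalfPlane.continuous_im.pow 2)).measurable
  refine Integrable.mono' ((integrableOn_normSq_mul_imSq hf hF).add (integrableOn_normSq_mul_imSq hg hG))
    hm.aestronglyMeasurable (Filter.Eventually.of_forall fun τ => ?_)
  rw [Real.norm_eq_abs]
  exact abs_re_mul_conj_mul_le _ _ _

variable {D M : ℕ} {C : Finset ℕ} {X : CartanLevelCurveData D M C} {q : ℕ}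

namespace CoverReduction

variable [Fact q.Prime] (R : CoverReduction X q)

/-- **The real Petersson pairing** `⟨v, w⟩ = Σ_g ∫_{Fq} Re(v_g w̄_g) y² dμ` of two induced vectors. -/
def petPair (Fq : Set ℍ) (v w : R.IndCuspForm) : ℝ :=
  ∑ g : GL (Fin 2) (ZMod q), ∫ τ in Fq, (((v.1 g) τ) * conj ((w.1 g) τ)).re * τ.im ^ 2

/-- The (GRAM) finiteness hypothesis on `u` over the domain `Fq`. -/
def FinitePet (Fq : Set ℍ) (u : R.IndCuspForm) : Prop :=
  ∀ g : GL (Fin 2) (ZMod q), ∫⁻ τ in Fq, ENNReal.ofReal (‖(u.1 g) τ‖ ^ 2 * τ.im ^ 2) < ⊤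

variable {R}

/-- Finiteness for every vector of `ℂ[G]·u`. -/
theorem FinitePet.of_mem_spanG {Fq : Set ℍ} {u : R.IndCuspForm} (hu : R.FinitePet Fq u) {v : R.IndCuspForm}
    (hv : v ∈ R.spanG u) : R.FinitePet Fq v :=
  R.setLIntegral_pet_lt_top_of_mem_spanG u hu hv

variable (R)

/-- Symmetry: `⟨v, w⟩ = ⟨w, v⟩`. -/
theorem petPair_comm (Fq : Set ℍ) (v w : R.IndCuspForm) : R.petPair Fq v w = R.petPair Fq w v := by
  unfold petPair
  refine Finset.sum_congr rfl fun g _ => ?_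
  refine integral_congr_ae (Filter.Eventually.of_forall fun τ => ?_)
  show ((v.1 g) τ * conj ((w.1 g) τ)).re * τ.im ^ 2 = ((w.1 g) τ * conj ((v.1 g) τ)).re * τ.im ^ 2
  rw [← Complex.conj_re ((v.1 g) τ * conj ((w.1 g) τ)), map_mul, Complex.conj_conj, mul_comm (conj ((v.1 g) τ))]

/-- `indRep`-invariance: `⟨g'v, g'w⟩ = ⟨v, w⟩`. -/
theorem petPair_indRep (Fq : Set ℍ) (g' : GL (Fin 2) (ZMod q)) (v w : R.IndCuspForm) :
    R.petPair Fq (R.indRep g' v) (R.indRep g' w) = R.petPair Fq v w := by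
  unfold petPair
  simp_rw [R.indRep_apply]
  exact Fintype.sum_equiv (Equiv.mulRight g') _ _ (fun g => rfl)

/-- Additivity in the first variable (under finiteness). -/
theorem petPair_add_left (Fq : Set ℍ) {v v' w : R.IndCuspForm} (hv : R.FinitePet Fq v) (hv' : R.FinitePet Fq v')
    (hw : R.FinitePet Fq w) : R.petPair Fq (v + v') w = R.petPair Fq v w + R.petPair Fq v' w := by
  unfold petPair
  rw [← Finset.sum_add_distrib]
  refine Finset.sum_congr rfl fun g _ => ?_
  have e : ∀ τ : ℍ, (((v + v').1 g) τ * conj ((w.1 g) τ)).re * τ.im ^ 2 =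
      ((v.1 g) τ * conj ((w.1 g) τ)).re * τ.im ^ 2 + ((v'.1 g) τ * conj ((w.1 g) τ)).re * τ.im ^ 2 := by
    intro τ
    have h : ((v + v').1 g) τ = (v.1 g) τ + (v'.1 g) τ := by
      change ((v.1 + v'.1) g) τ = _
      rw [Pi.add_apply, CuspForm.add_apply]
    rw [h, add_mul, Complex.add_re, add_mul]
  simp_rw [e]
  exact integral_add (integrableOn_re_mul_conj_mul_imSq (v.1 g).holo'.continuous (w.1 g).holo'.continuous (hv g) (hw g))
    (integrableOn_re_mul_conj_mul_imSq (v'.1 g).holo'.continuous (w.1 g).holo'.continuous (hv' g) (hw g))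

/-- Real homogeneity in the first variable. -/
theorem petPair_smul_left (Fq : Set ℍ) (c : ℝ) (v w : R.IndCuspForm) :
    R.petPair Fq ((c : ℂ) • v) w = c * R.petPair Fq v w := by
  unfold petPair
  rw [Finset.mul_sum]
  refine Finset.sum_congr rfl fun g _ => ?_
  have e : ∀ τ : ℍ, ((((c : ℂ) • v).1 g) τ * conj ((w.1 g) τ)).re * τ.im ^ 2 =
      c * (((v.1 g) τ * conj ((w.1 g) τ)).re * τ.im ^ 2) := by
    intro τ
    have h : (((c : ℂ) • v).1 g) τ = (c : ℂ) * (v.1 g) τ := by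
      change (((c : ℂ) • v.1) g) τ = _
      rw [Pi.smul_apply, CuspForm.IsGLPos.smul_apply, smul_eq_mul]
    rw [h, mul_assoc, Complex.re_ofReal_mul, mul_assoc]
  simp_rw [e]
  exact integral_const_mul c _

/-- `⟨v, v⟩ = (Σ_g ∫⁻_{Fq} ‖v_g‖² y²).toReal`. -/
theorem petPair_self (Fq : Set ℍ) {v : R.IndCuspForm} (hv : R.FinitePet Fq v) :
    R.petPair Fq v v = (∑ g : GL (Fin 2) (ZMod q), ∫⁻ τ in Fq, ENNReal.ofReal (‖(v.1 g) τ‖ ^ 2 * τ.im ^ 2)).toReal := by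
  unfold petPair
  rw [ENNReal.toReal_sum (fun g _ => (hv g).ne)]
  refine Finset.sum_congr rfl fun g _ => ?_
  have e : ∀ τ : ℍ, ((v.1 g) τ * conj ((v.1 g) τ)).re * τ.im ^ 2 = ‖(v.1 g) τ‖ ^ 2 * τ.im ^ 2 := by
    intro τ
    rw [Complex.mul_conj, Complex.ofReal_re, Complex.normSq_eq_norm_sq]
  simp_rw [e]
  have hc : Continuous (⇑(v.1 g) : ℍ → ℂ) := (v.1 g).holo'.continuous
  have hm : Measurable (fun τ : ℍ => ‖(v.1 g) τ‖ ^ 2 * τ.im ^ 2) :=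
    (((continuous_norm.comp hc).pow 2).mul (UpperHalfPlane.continuous_im.pow 2)).measurable
  exact integral_eq_lintegral_of_nonneg_ae (Filter.Eventually.of_forall fun τ => by positivity) hm.aestronglyMeasurable

/-- **Positivity**: `⟨v, v⟩ > 0` for `v ≠ 0` with finite norms, over a fundamental domain of `Γ̄(q)`. -/
theorem petPair_self_pos {Fq : Set ℍ} (hFq : IsHypFundamentalDomain (principalLevel X q) Fq) {v : R.IndCuspForm}
    (hv : R.FinitePet Fq v) (hv0 : v ≠ 0) : 0 < R.petPair Fq v v := by
  rw [R.petPair_self Fq hv, ENNReal.toReal_sum (fun g _ => (hv g).ne)]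
  -- some component is non-zero
  have hex : ∃ g : GL (Fin 2) (ZMod q), (⇑(v.1 g) : ℍ → ℂ) ≠ 0 := by
    by_contra h
    simp only [ne_eq, not_exists, not_not] at h
    apply hv0
    apply Subtype.ext
    funext g
    exact CuspForm.ext fun τ => by simpa using congrFun (h g) τ
  obtain ⟨g₀, hg₀⟩ := hex
  refine lt_of_lt_of_le ?_ (Finset.single_le_sum (fun g _ => ENNReal.toReal_nonneg) (Finset.mem_univ g₀))
  exact ENNReal.toReal_pos (R.setLIntegral_pet_pos_of_ne_zero hFq v g₀ hg₀).ne' (hv g₀).ne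

end CoverReduction

end Summit.BirchSwinnertonDyer.BirchSwinnertonDyer.Theorems.CartanCover

end
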